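import Summits.BirchSwinnertonDyer.BirchSwinnertonDyer.Theorems.AlignedTransportAtTwoMainConjectureOfRankZeroBSDAtTwoCubicLayerOneDoors
import Literature.NumberTheory.EllipticCurves.ZpExtensionLayerCharacter
import Literature.NumberTheory.IwasawaTheory.ZpExtensionLayerRamificationDichotomy
import HarnessLib

/-!
# Route `AlignedTransportAtTwo`, crux C2 `MainConjectureOfRankZeroBSDAtTwo` (stmt-BirchSwinnertonDyer-22298):
# CHEVALLEY ALONG THE WHOLE CYCLOTOMIC `ℤ₂`-TOWER OF A KILFORD CUBIC FIELD — `e_n ≥ e_0 + n − 1` at EVERY layer, the `2`-class number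
# JUMPS at every layer (Fukuda), so the ORDER-form layer door is dead on the Kilford stratum; `λ₂ ≥ 1` reading

HONEST FRAMING (cell `bsd-f1-sign2`, WIDTH-5 attached prover seat `bsd-line-att-p3` gen 25 on line `birth` of the lead `bsd-line-att-p2`;
`--supports` stmt-BirchSwinnertonDyer-22298, closes nothing; BSD is NOT proved by any of this; the crux C2, its verdict «blocked-on
`Rank1Residual.GreenbergMuConjectureIrreducible`» and every registered stub are untouched). THEOREMS ONLY — no definition, no named fact,
no `sorry`; every arithmetic input is a DISPLAYED hypothesis (in particular «three places above `2` in `ℚ(β)`», exactly as in att-p5 g25's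
`…CubicLayerOneDoors`).

WHY. att-p5 g24/g25 reduced the `Δ_W < 0` input of C2 to H3M⁻ = «`μ₂ = 0` for the cyclotomic `ℤ₂`-extension of the cubic field `K = ℚ(e₁)`
of every seed» and typed, per seed, the layer-`(n, n+1)` doors of Fukuda 1994 Thm. 1: ORDER form (`e_{n+1} = e_n` for SOME `n` ⟹ `μ = 0`,
`…CubicLayerOneDoors.mazurMainConjecture_two_of_muIneqRel_of_threePrimes_of_classNumberPExp_succ_eq`) and RANK form (`r_{n+1} = r_n`).
g25 showed by Chevalley's formula at the FIRST layer that `e₁ ≥ e₀ + 1` when `2` splits completely in `K` (all twelve certified seeds).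
This file runs Chevalley's ambiguous class number formula (Lang, *Cyclotomic Fields*, Ch. 13 §4, Lemma 4.1–4.2 — the TREE THEOREM
`AmbiguousClass.dvd_card_fixed_mul`, valid for ANY cyclic `L/K`) at EVERY layer `K_n/K` (cyclic of degree `2ⁿ`):

* §1 (generic): for `K` of odd degree and unit rank `1` (a complex cubic field) the unit index `[E_K : E_K^{2ⁿ}]` divides `2^{n+1}`
  (`E_K = ±ε^ℤ`, `relIndex_map_pow_dvd`); hence for `L/K` cyclic of degree `2ⁿ` with `2^{mn} ∣ ∏_𝔭 e_𝔭` (e.g. `m` primes of index `2ⁿ`)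
  **`ord₂ h_K + m·n ≤ ord₂ h_L + 2n + 1`** (`padicValNat_classNumber_add_le`).
* §2 (tower): for a cyclotomic `ℤ₂`-extension `κ` of `K` (odd degree) all of whose places above `2` have odd absolute index, every such place is
  TOTALLY ramified in `K_n/K` (`ramificationIdxIn_layer_eq_pow`: Fukuda's index is `0`, tree p687770, + the inertia dichotomy
  `ZpExtension.inertia_layer_eq_bot_or_forall_mem` + `√2 ∈ K_n` + Mathlib `Ideal.card_inertia_eq_ramificationIdxIn`), so
  **`e_0 + m·n ≤ e_n + 2n + 1`** for `m ≤ #{w ∣ 2}` (`classNumberPExp_zero_add_le_layer`); with THREE places above `2`: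
  **`e_n ≥ e_0 + n − 1` for every `n`** (g25's `e₁ ≥ e₀ + 1` is `n = 1`) — `#Cl(K_n)[2^∞]` is UNBOUNDED.
* SEQUEL (`…CubicTowerJumps`): with Fukuda's Thm. 1 (1) (tree `_holds`) the `2`-class number jumps at EVERY layer, so the ORDER-form door is
  void on the Kilford stratum, and `μ = 0 ⟹ λ ≥ 1`; the cubic and seed-cell forms live there.

References: [Lang1990] Ch. 13 §4, Lemma 4.1–4.2 (PDF pp. 203–204); [Gras2003] II.6.2.3; [Washington1997] §13.1 Lemma 13.3, Prop. 13.2, §13.3;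
[Fukuda1994] Thm. 1 (1), p. 264; [NeukirchANT1999] Ch. I §7 Thm. (7.4), §9 Prop. (9.6); [Iwasawa1973MuInvariants]; tree p742953/p743166 (att-p5 g25),
p687770, `AmbiguousClassNumberFormula`, `Fukuda1994Thm1Proofs`.
-/

set_option linter.dupNamespace false
set_option autoImplicit false

noncomputable section

open scoped Classical NumberField nonZeroDivisors

namespace Summit.BirchSwinnertonDyer.BirchSwinnertonDyer.Theorems.AlignedTransportAtTwoCubicTowerGrowth

open NumberField IsDedekindDomain
open Literature.NumberTheory.NumberFields Literature.NumberTheory.NumberFields.AmbiguousClass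
  Literature.NumberTheory.NumberFields.AmbiguousIdeal
  Literature.NumberTheory.GaloisRepresentations
  Literature.NumberTheory.GaloisRepresentations.Herbrand Literature.NumberTheory.GaloisRepresentations.MinkowskiUnit
  Literature.NumberTheory.GaloisRepresentations.CyclicNormIndex Literature.NumberTheory.IwasawaTheory
  Literature.NumberTheory.EllipticCurves
  Summit.BirchSwinnertonDyer.BirchSwinnertonDyer.Theorems.AddKatoTwo
  Summit.BirchSwinnertonDyer.BirchSwinnertonDyer.Theorems.AlignedTransportAtTwoCubicLayerOneParity
  Summit.BirchSwinnertonDyer.BirchSwinnertonDyer.Theorems.AlignedTransportAtTwoCubicLayerOneDoors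

/-! ## §1 Chevalley at a cyclic layer of degree `2ⁿ`, downward -/

section Chevalley

variable {K L : Type} [Field K] [NumberField K] [Field L] [NumberField L] [Algebra K L]

/-- **`[E_K : E_K^{2ⁿ}] ∣ 2^{n+1}` for a field of odd degree and unit rank `1`** (inside `Lˣ`, `E_K = 𝓞_Lˣ ∩ Kˣ`): every unit is `±ε^j`
(Dirichlet), so `E_K / E_K^{2ⁿ}` is generated by the classes of `−1` and `ε`, has at most `2 · 2ⁿ` elements and exponent dividing `2ⁿ`,
hence is a `2`-group of order dividing `2^{n+1}`. [cite: NeukirchANT1999, Ch. I §7, Thm. (7.4)] [cite: Lang1990, Ch. 13 §4, proof of Lemma 4.2] -/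
theorem relIndex_map_pow_dvd (hK2 : Odd (Module.finrank ℚ K)) (hrank : Units.rank K = 1) (n : ℕ) :
    ((unitsE L ⊓ (unitsIncl K L).range).map (powMonoidHom (2 ^ n))).relIndex (unitsE L ⊓ (unitsIncl K L).range) ∣
      2 ^ (n + 1) := by
  set B := unitsE L ⊓ (unitsIncl K L).range with hB
  set A := B.map (powMonoidHom (2 ^ n)) with hA
  set H : Subgroup B := A.subgroupOf B with hH
  have hidx : A.relIndex B = Nat.card (B ⧸ H) := rfl
  -- powers `b^{2ⁿ}` of elements of `B` lie in `A`
  have hpow : ∀ b : B, ((b : Lˣ) ^ (2 ^ n)) ∈ A := fun b => ⟨b, b.2, rfl⟩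
  -- the fundamental unit and `-1`
  obtain ⟨ε, hε⟩ := exists_eq_pm_zpow_of_rank_eq_one (K := K) hK2 hrank
  set ι : (𝓞 K)ˣ →* Lˣ := (unitsIncl K L).comp (Units.map (algebraMap (𝓞 K) K : 𝓞 K →* K)) with hι
  have hιmem : ∀ v : (𝓞 K)ˣ, ι v ∈ B := fun v => unitsIncl_map_mem v
  have hιneg : ι (-1) = -1 := Units.ext (by rw [hι, MonoidHom.comp_apply, coe_unitsIncl]; simp)
  let e0 : B := ⟨ι ε, hιmem ε⟩
  let m1 : B := ⟨ι (-1), hιmem (-1)⟩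
  -- surjection `Bool × Fin (2ⁿ) → B ⧸ H`
  let φ : Bool × Fin (2 ^ n) → B ⧸ H := fun c => QuotientGroup.mk ((cond c.1 m1 1) * e0 ^ (c.2 : ℕ))
  have hφ : Function.Surjective φ := by
    intro q
    obtain ⟨y, rfl⟩ := QuotientGroup.mk_surjective q
    obtain ⟨v, hv⟩ := exists_ringOfIntegers_unit_of_mem (K := K) (L := L) y.2
    have hv' : ι v = (y : Lˣ) := hv
    obtain ⟨j, hj⟩ := hε v
    -- `y = s · ι ε ^ j` with `s ∈ {1, -1}`
    have hy : ∃ b : Bool, (y : Lˣ) = (cond b (ι (-1)) 1) * ι ε ^ j := by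
      rcases hj with h | h
      · exact ⟨false, by rw [← hv', h, map_zpow]; simp⟩
      · exact ⟨true, by rw [← hv', h, ← neg_one_mul, map_mul, map_zpow]; rfl⟩
    obtain ⟨b, hb⟩ := hy
    -- reduce `j` modulo `2ⁿ`
    set N : ℤ := (2 : ℤ) ^ n with hN
    have hN0 : 0 < N := by positivity
    set r : ℤ := j % N with hr
    set qq : ℤ := j / N with hqq
    have hjr : j = N * qq + r := (Int.mul_ediv_add_emod j N).symm
    have hr0 : 0 ≤ r := Int.emod_nonneg _ hN0.ne'
    have hrN : r < N := Int.emod_lt_of_pos _ hN0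
    have hrnat : (r.toNat : ℤ) = r := Int.toNat_of_nonneg hr0
    have hrlt : r.toNat < 2 ^ n := by
      have : (r.toNat : ℤ) < (2 : ℤ) ^ n := by rw [hrnat]; exact hrN
      exact_mod_cast this
    refine ⟨(b, ⟨r.toNat, hrlt⟩), ?_⟩
    change QuotientGroup.mk ((cond b m1 1) * e0 ^ r.toNat) = QuotientGroup.mk y
    rw [QuotientGroup.eq, hH, Subgroup.mem_subgroupOf]
    -- `((s e0^r)⁻¹ * y) = (ι ε ^ qq) ^ (2ⁿ)` lies in `A`
    have hcalc : (((cond b m1 1 * e0 ^ r.toNat)⁻¹ * y : B) : Lˣ) = ((ι ε ^ qq) ^ (2 ^ n) : Lˣ) := by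
      have hs : ((cond b m1 1 : B) : Lˣ) = cond b (ι (-1)) 1 := by cases b <;> rfl
      rw [Subgroup.coe_mul, Subgroup.coe_inv, Subgroup.coe_mul, Subgroup.coe_pow, hs, hb]
      change (cond b (ι (-1)) 1 * ι ε ^ r.toNat)⁻¹ * (cond b (ι (-1)) 1 * ι ε ^ j) = (ι ε ^ qq) ^ (2 ^ n)
      have hcomm : (cond b (ι (-1)) 1 * ι ε ^ r.toNat)⁻¹ * (cond b (ι (-1)) 1 * ι ε ^ j) = (ι ε ^ (r.toNat : ℤ))⁻¹ * ι ε ^ j := by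
        rw [mul_inv_rev, zpow_natCast, mul_assoc, inv_mul_cancel_left]
      rw [hcomm, ← zpow_neg, ← zpow_add, hrnat, hjr, ← zpow_natCast, ← zpow_mul]
      congr 1
      push_cast
      rw [hN]; ring
    have hmemB : ι ε ^ qq ∈ B := B.zpow_mem (hιmem ε) qq
    have : ((ι ε ^ qq) ^ (2 ^ n) : Lˣ) ∈ A := hpow ⟨ι ε ^ qq, hmemB⟩
    rw [hcalc]
    exact this
  haveI : Finite (B ⧸ H) := Finite.of_surjective φ hφ
  have hle : Nat.card (B ⧸ H) ≤ 2 ^ (n + 1) := by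
    have := Nat.card_le_card_of_surjective φ hφ
    simpa [Nat.card_prod, pow_succ, mul_comm] using this
  -- `B ⧸ H` is a `2`-group: `x^{2ⁿ} = 1`
  haveI : Fact (Nat.Prime 2) := ⟨Nat.prime_two⟩
  have hP : IsPGroup 2 (B ⧸ H) := by
    intro x
    obtain ⟨y, rfl⟩ := QuotientGroup.mk_surjective x
    refine ⟨n, ?_⟩
    rw [← QuotientGroup.mk_pow, QuotientGroup.eq_one_iff, hH, Subgroup.mem_subgroupOf, Subgroup.coe_pow]
    exact hpow y
  obtain ⟨k, hk⟩ := IsPGroup.iff_card.mp hP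
  rw [hidx, hk]
  rw [hk] at hle
  exact pow_dvd_pow 2 ((Nat.pow_le_pow_iff_right (by norm_num)).mp hle)

/-- **Chevalley at a cyclic layer of degree `2ⁿ`, downward.** `L/K` cyclic of degree `2ⁿ`, `K` of odd degree and unit rank `1`,
and `2^{mn} ∣ ∏_𝔭 e_𝔭(L/K)` (e.g. `m` primes of `K` with index `2ⁿ` in `L`): then **`ord₂ h_K + m·n ≤ ord₂ h_L + 2n + 1`**.
Lang's Lemma 4.1–4.2 (tree `AmbiguousClass.dvd_card_fixed_mul`): `h_K · ∏_𝔭 e_𝔭 · e_∞ ∣ #Cl(L)^G · [L:K] · [E_K : E_K^{[L:K]}]`, with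
`#Cl(L)^G ∣ h_L` and `[E_K : E_K^{2ⁿ}] ∣ 2^{n+1}` (`relIndex_map_pow_dvd`). [cite: Lang1990, Ch. 13 §4, Lemma 4.1–4.2 (PDF pp. 203–204)]
[cite: Gras2003, II.6.2.3] -/
theorem padicValNat_classNumber_add_le [IsGalois K L] [IsCyclic (L ≃ₐ[K] L)] (hK2 : Odd (Module.finrank ℚ K))
    (hrank : Units.rank K = 1) {n m : ℕ} (hdeg : Module.finrank K L = 2 ^ n)
    (hm : 2 ^ (m * n) ∣ ∏ᶠ v : HeightOneSpectrum (𝓞 K), v.asIdeal.ramificationIdxIn (𝓞 L)) :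
    padicValNat 2 (classNumber K) + m * n ≤ padicValNat 2 (classNumber L) + (2 * n + 1) := by
  haveI : Fact (Nat.Prime 2) := ⟨Nat.prime_two⟩
  haveI : FiniteDimensional K L := Module.Finite.of_restrictScalars_finite ℚ K L
  obtain ⟨σ, hσ⟩ := IsCyclic.exists_generator (α := L ≃ₐ[K] L)
  have h := dvd_card_fixed_mul hσ
  rw [hdeg] at h
  set F := Nat.card {c : ClassGroup (𝓞 L) // ∀ τ : L ≃ₐ[K] L, ClassGroup.mulEquiv (intAut τ) c = c} with hF
  have hFdvd : F ∣ classNumber L := card_fixed_dvd_classNumber (K := K) (L := L)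
  have hI := relIndex_map_pow_dvd (K := K) (L := L) hK2 hrank n
  -- `2^a ∣ h_K`
  have ha : 2 ^ padicValNat 2 (classNumber K) ∣ classNumber K := pow_padicValNat_dvd
  -- the divisibility chain
  have h1 : 2 ^ (padicValNat 2 (classNumber K) + m * n) ∣ classNumber L * 2 ^ (2 * n + 1) := by
    have step1 : 2 ^ (padicValNat 2 (classNumber K) + m * n) ∣
        classNumber K * (∏ᶠ v : HeightOneSpectrum (𝓞 K), v.asIdeal.ramificationIdxIn (𝓞 L)) *
          ArchHerbrand.archFactor K L := by
      rw [pow_add]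
      exact (mul_dvd_mul ha hm).trans (dvd_mul_right _ _)
    have step2 : F * 2 ^ n *
        ((unitsE L ⊓ (unitsIncl K L).range).map (powMonoidHom (2 ^ n))).relIndex (unitsE L ⊓ (unitsIncl K L).range) ∣
        classNumber L * 2 ^ (2 * n + 1) := by
      have : classNumber L * 2 ^ (2 * n + 1) = classNumber L * 2 ^ n * 2 ^ (n + 1) := by ring
      rw [this]
      exact mul_dvd_mul (mul_dvd_mul_right hFdvd _) hI
    exact step1.trans (h.trans step2)
  have hne : classNumber L * 2 ^ (2 * n + 1) ≠ 0 := mul_ne_zero (classNumber_ne_zero L) (pow_ne_zero _ two_ne_zero)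
  have h2 := (padicValNat_dvd_iff_le hne).mp h1
  rwa [padicValNat.mul (classNumber_ne_zero L) (pow_ne_zero _ two_ne_zero), padicValNat.prime_pow] at h2

end Chevalley

/-! ## §2 The cyclotomic `ℤ₂`-tower: total ramification at every layer and `e_0 + m·n ≤ e_n + 2n + 1` -/

section Tower

variable {K : Type} [Field K] [NumberField K]

/-- **`Gal(K_n/K)` is cyclic** (of order `2ⁿ`; the layer character `κ mod 2ⁿ`, tree `ZpExtension.exists_cyclicCharacter_layer` +
`isCyclic_of_cyclicLayer`). [cite: Washington1997, §13.1] -/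
theorem isCyclic_aut_layer (κ : ZpExtension K 2) (n : ℕ) : IsCyclic ((κ.layer n) ≃ₐ[K] (κ.layer n)) := by
  haveI : IsGalois K (κ.layer n) := κ.isGalois_layer_holds n
  obtain ⟨ψ, -, hker, -⟩ := κ.exists_cyclicCharacter_layer n
  exact isCyclic_of_cyclicLayer ψ (κ.layer n) hker

omit [NumberField K] in
/-- A place of `K` containing `2` lies over `(2) ⊂ ℤ`. [folklore] -/
theorem liesOver_span_two_of_mem (w : HeightOneSpectrum (𝓞 K)) (hw : ((2 : ℕ) : 𝓞 K) ∈ w.asIdeal) :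
    w.asIdeal.LiesOver (Ideal.span {(2 : ℤ)}) := by
  rw [Ideal.liesOver_span_iff w.isPrime.ne_top Int.prime_two, map_ofNat]
  exact_mod_cast hw

/-- **Total ramification at EVERY layer.** `K` of odd degree, `κ` a cyclotomic `ℤ₂`-extension of `K` all of whose places above `2` have ODD
absolute ramification index (so Fukuda's index is `0`, tree `totallyRamifiedFrom_zero_of_forall_odd_ramificationIdx`), `w ∣ 2` a place of
`K` and `n ≥ 1`: then `e(w, K_n/K) = 2ⁿ = [K_n : K]`. (A prime `Q ∣ w` of `K_n` has even `e(Q ∣ 2) = e(w ∣ 2) · e(Q ∣ w)` since `√2 ∈ K₁ ⊆ K_n`,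
so `Q` is ramified over `w`; by the inertia dichotomy in the layers of a `ℤ_p`-extension with Fukuda index `0`
(`ZpExtension.inertia_layer_eq_bot_or_forall_mem`) its inertia group is all of `Gal(K_n/K)`, of order `2ⁿ`, and `#I(Q) = e(w, K_n/K)`
(Mathlib `Ideal.card_inertia_eq_ramificationIdxIn`).) [cite: Washington1997, §13.1 Lemma 13.3 and Prop. 13.2] [cite: NeukirchANT1999, Ch. I §9 Prop. (9.6)] -/
theorem ramificationIdxIn_layer_eq_pow (hK2 : ¬ 2 ∣ Module.finrank ℚ K) (κ : ZpExtension K 2) (hκ : κ.IsCyclotomic)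
    (hodd : ∀ w : HeightOneSpectrum (𝓞 K), ((2 : ℕ) : 𝓞 K) ∈ w.asIdeal → Odd (w.asIdeal.ramificationIdx ℤ))
    {w : HeightOneSpectrum (𝓞 K)} (hw : ((2 : ℕ) : 𝓞 K) ∈ w.asIdeal) {n : ℕ} (hn : 1 ≤ n) :
    haveI : FiniteDimensional K (κ.layer n) := κ.finiteDimensional_layer_holds n
    w.asIdeal.ramificationIdxIn (𝓞 (κ.layer n)) = 2 ^ n := by
  haveI : FiniteDimensional K (κ.layer n) := κ.finiteDimensional_layer_holds n
  haveI : IsGalois K (κ.layer n) := κ.isGalois_layer_holds n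
  haveI : NumberField (κ.layer n) := NumberField.of_module_finite K _
  have hram : TotallyRamifiedFrom κ 0 := totallyRamifiedFrom_zero_of_forall_odd_ramificationIdx hK2 κ hκ hodd
  -- `√2 ∈ K_n`
  obtain ⟨θ₁, hθ₁⟩ := exists_sq_eq_two_layer_one_of_not_dvd_finrank hK2 κ hκ
  have hle : κ.layer 1 ≤ κ.layer n := κ.layer_mono hn
  set θ : κ.layer n := ⟨(θ₁ : AlgebraicClosure K), hle θ₁.2⟩ with hθdef
  have h1 : (algebraMap (κ.layer 1) (AlgebraicClosure K) θ₁) ^ 2 = 2 := by rw [← map_pow, hθ₁, map_ofNat]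
  have hθ : θ ^ 2 = 2 := by
    apply (algebraMap (κ.layer n) (AlgebraicClosure K)).injective
    rw [map_pow, map_ofNat]
    exact h1
  -- a prime `Q ∣ w` of `K_n`
  haveI : w.asIdeal.IsPrime := w.isPrime
  haveI := liesOver_span_two_of_mem w hw
  obtain ⟨⟨Q, hQprime, hQover⟩⟩ :=
    (inferInstance : Nonempty (Ideal.primesOver w.asIdeal (𝓞 (κ.layer n))))
  haveI := hQprime
  haveI := hQover
  haveI : Q.LiesOver (Ideal.span {(2 : ℤ)}) := Ideal.LiesOver.trans Q w.asIdeal _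
  -- `e(Q ∣ w)` is not `1`
  have heven := even_ramificationIdx_int_of_sq_eq_two hθ Q
  rw [Ideal.ramificationIdx_tower w.asIdeal Q] at heven
  have hne1 : Q.ramificationIdx (𝓞 K) ≠ 1 := by
    intro h1
    rw [h1, mul_one] at heven
    exact (Nat.not_even_iff_odd.mpr (hodd w hw)) heven
  -- `Q` is maximal
  have hQ0 : Q ≠ ⊥ := Ideal.ne_bot_of_liesOver_of_ne_bot w.ne_bot Q
  haveI hQmax : Q.IsMaximal := hQprime.isMaximal hQ0
  -- `#I(Q) = e(w, K_n/K)`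
  haveI : Module.Finite (𝓞 K) (𝓞 (κ.layer n)) := IsIntegralClosure.finite (𝓞 K) K (κ.layer n) (𝓞 (κ.layer n))
  haveI : IsGaloisGroup ((κ.layer n) ≃ₐ[K] (κ.layer n)) (𝓞 K) (𝓞 (κ.layer n)) :=
    IsGaloisGroup.of_isFractionRing _ (𝓞 K) (𝓞 (κ.layer n)) K (κ.layer n)
  have hcard := Ideal.card_inertia_eq_ramificationIdxIn (G := (κ.layer n) ≃ₐ[K] (κ.layer n)) w.asIdeal Q
  have hidx := Ideal.ramificationIdxIn_eq_ramificationIdx w.asIdeal Q ((κ.layer n) ≃ₐ[K] (κ.layer n))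
  rcases κ.inertia_layer_eq_bot_or_forall_mem hram le_rfl (Nat.zero_le n) Q with h0 | hall
  · exfalso
    rw [h0, Subgroup.card_bot] at hcard
    exact hne1 (by rw [← hidx, ← hcard])
  · have htop : Q.inertia ((κ.layer n) ≃ₐ[K] (κ.layer n)) = ⊤ := by
      rw [eq_top_iff]
      intro g _
      refine hall g fun x hx => ?_
      rw [κ.layer_zero] at hx
      obtain ⟨c, hc⟩ := IntermediateField.mem_bot.mp hx
      have hxc : x = algebraMap K (κ.layer n) c := Subtype.ext hc.symm
      rw [hxc, AlgEquiv.commutes]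
    rw [htop, Subgroup.card_top, IsGalois.card_aut_eq_finrank, κ.finrank_layer_holds n] at hcard
    exact hcard.symm

/-- **`2^{mn} ∣ ∏_𝔭 e_𝔭(K_n/K)` when `m ≤ #{w ∣ 2}`** (every place above `2` has index `2ⁿ` by `ramificationIdxIn_layer_eq_pow`).
[cite: Washington1997, §13.1] [cite: Lang1990, Ch. 13 §4, proof of Lemma 4.2 (PDF p. 204)] -/
theorem pow_dvd_finprod_ramificationIdxIn_layer (hK2 : ¬ 2 ∣ Module.finrank ℚ K) (κ : ZpExtension K 2) (hκ : κ.IsCyclotomic)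
    (hodd : ∀ w : HeightOneSpectrum (𝓞 K), ((2 : ℕ) : 𝓞 K) ∈ w.asIdeal → Odd (w.asIdeal.ramificationIdx ℤ))
    {m : ℕ} (hm : m ≤ {w : HeightOneSpectrum (𝓞 K) | ((2 : ℕ) : 𝓞 K) ∈ w.asIdeal}.ncard) {n : ℕ} (hn : 1 ≤ n) :
    haveI : FiniteDimensional K (κ.layer n) := κ.finiteDimensional_layer_holds n
    2 ^ (m * n) ∣ ∏ᶠ v : HeightOneSpectrum (𝓞 K), v.asIdeal.ramificationIdxIn (𝓞 (κ.layer n)) := by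
  classical
  haveI : FiniteDimensional K (κ.layer n) := κ.finiteDimensional_layer_holds n
  haveI : IsGalois K (κ.layer n) := κ.isGalois_layer_holds n
  haveI : NumberField (κ.layer n) := NumberField.of_module_finite K _
  set f : HeightOneSpectrum (𝓞 K) → ℕ := fun v => v.asIdeal.ramificationIdxIn (𝓞 (κ.layer n)) with hf
  set S := {w : HeightOneSpectrum (𝓞 K) | ((2 : ℕ) : 𝓞 K) ∈ w.asIdeal} with hS
  have hfS : ∀ w ∈ S, f w = 2 ^ n := fun w hw => ramificationIdxIn_layer_eq_pow hK2 κ hκ hodd hw hn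
  have h2n : (2 : ℕ) ^ n ≠ 1 := by
    have : 2 ≤ 2 ^ n := by
      calc (2 : ℕ) = 2 ^ 1 := by norm_num
        _ ≤ 2 ^ n := Nat.pow_le_pow_right (by norm_num) hn
    omega
  have hT := finite_setOf_ramificationIdxIn_ne_one (K := K) (L := κ.layer n)
  have hST : S ⊆ {v : HeightOneSpectrum (𝓞 K) | v.asIdeal.ramificationIdxIn (𝓞 (κ.layer n)) ≠ 1} := fun w hw => by
    change f w ≠ 1
    rw [hfS w hw]; exact h2n
  have hSfin : S.Finite := hT.subset hST
  have hsupp : Function.mulSupport f ⊆ ↑hT.toFinset := fun v hv => by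
    rw [Set.Finite.coe_toFinset]; exact hv
  rw [finprod_eq_prod_of_mulSupport_subset f hsupp]
  have hsub : hSfin.toFinset ⊆ hT.toFinset := by
    intro v hv
    rw [Set.Finite.mem_toFinset] at hv ⊢
    exact hST hv
  have hprodS : ∏ v ∈ hSfin.toFinset, f v = 2 ^ (n * S.ncard) := by
    rw [Finset.prod_congr rfl (fun v hv => hfS v ((Set.Finite.mem_toFinset hSfin).mp hv)), Finset.prod_const,
      ← Set.ncard_eq_toFinset_card S hSfin, ← pow_mul]
  have hdvd : ∏ v ∈ hSfin.toFinset, f v ∣ ∏ v ∈ hT.toFinset, f v := Finset.prod_dvd_prod_of_subset _ _ _ hsub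
  rw [hprodS] at hdvd
  refine (pow_dvd_pow 2 ?_).trans hdvd
  rw [mul_comm]
  exact Nat.mul_le_mul_left n hm

/-- **`e_0 + m·n ≤ e_n + 2n + 1` ALONG THE TOWER.** `K` of odd degree and unit rank `1`, `κ` cyclotomic with all places above `2` of odd
index, `m ≤ #{w ∣ 2}`: for every `n`, `ord₂ h(K) + m·n ≤ ord₂ h(K_n) + 2n + 1` (Chevalley at the cyclic layer `K_n/K` of degree `2ⁿ`,
§1, with `m` totally ramified places). [cite: Lang1990, Ch. 13 §4, Lemma 4.1–4.2 (PDF pp. 203–204)] [cite: Washington1997, §13.1]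
[cite: Fukuda1994, p. 264 (notation `e_n`)] -/
theorem classNumberPExp_zero_add_le_layer (hK2 : ¬ 2 ∣ Module.finrank ℚ K) (hrank : Units.rank K = 1)
    (κ : ZpExtension K 2) (hκ : κ.IsCyclotomic)
    (hodd : ∀ w : HeightOneSpectrum (𝓞 K), ((2 : ℕ) : 𝓞 K) ∈ w.asIdeal → Odd (w.asIdeal.ramificationIdx ℤ))
    {m : ℕ} (hm : m ≤ {w : HeightOneSpectrum (𝓞 K) | ((2 : ℕ) : 𝓞 K) ∈ w.asIdeal}.ncard) (n : ℕ) :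
    classNumberPExp κ 0 + m * n ≤ classNumberPExp κ n + (2 * n + 1) := by
  haveI : Fact (Nat.Prime 2) := ⟨Nat.prime_two⟩
  rcases Nat.eq_zero_or_pos n with rfl | hn
  · simp
  haveI : FiniteDimensional K (κ.layer n) := κ.finiteDimensional_layer_holds n
  haveI : IsGalois K (κ.layer n) := κ.isGalois_layer_holds n
  haveI : NumberField (κ.layer n) := NumberField.of_module_finite K _
  haveI : IsCyclic ((κ.layer n) ≃ₐ[K] (κ.layer n)) := isCyclic_aut_layer κ n
  have hodd' : Odd (Module.finrank ℚ K) := Nat.odd_iff.mpr (Nat.two_dvd_ne_zero.mp hK2)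
  have hdeg : Module.finrank K (κ.layer n) = 2 ^ n := κ.finrank_layer_holds n
  have h := padicValNat_classNumber_add_le (K := K) (L := κ.layer n) hodd' hrank hdeg
    (pow_dvd_finprod_ramificationIdxIn_layer hK2 κ hκ hodd hm hn)
  rw [classNumberPExp_zero_eq_padicValNat_classNumber, classNumberPExp_eq_padicValNat_classNumber]
  exact h

/-- **THREE places above `2`: `e_n ≥ e_0 + n − 1` at every layer** (`m = 3`; g25's `classNumberPExp_zero_succ_le_one` is `n = 1`), so
`#Cl(K_n)[2^∞]` is unbounded along the tower. [cite: Lang1990, Ch. 13 §4, Lemma 4.1–4.2] [cite: Washington1997, §13.1] -/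
theorem classNumberPExp_zero_add_le_layer_of_three_le (hK2 : ¬ 2 ∣ Module.finrank ℚ K) (hrank : Units.rank K = 1)
    (κ : ZpExtension K 2) (hκ : κ.IsCyclotomic)
    (hodd : ∀ w : HeightOneSpectrum (𝓞 K), ((2 : ℕ) : 𝓞 K) ∈ w.asIdeal → Odd (w.asIdeal.ramificationIdx ℤ))
    (h3 : 3 ≤ {w : HeightOneSpectrum (𝓞 K) | ((2 : ℕ) : 𝓞 K) ∈ w.asIdeal}.ncard) (n : ℕ) :
    classNumberPExp κ 0 + n ≤ classNumberPExp κ n + 1 := by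
  have := classNumberPExp_zero_add_le_layer hK2 hrank κ hκ hodd h3 n
  omega

end Tower

end Summit.BirchSwinnertonDyer.BirchSwinnertonDyer.Theorems.AlignedTransportAtTwoCubicTowerGrowth

end
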